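import Literature.Computability.AlgebraicComplexity.MultiYoungSymmetrizerRank
import HarnessLib

/-!
# `c^λ_{μ¹…μ^d} = 0` when some `μ^i` has more than `N` rows

Topic `Literature/Computability/AlgebraicComplexity` (val-lit cell, board U1 = `IK2020_prop_10_1`,
lemma (V) of `HOME/bip/NOTE-t01g3-IK2020Prop101-P2-bricks.md`). Theorems only.

Fulton–Harris Thm. 6.3 (1) / Fulton, *Young Tableaux* §8.1: `S_μ(k^N) = c_μ · (k^N)^{⊗|μ|} = 0`
when `μ` has more than `N` rows, because the column antisymmetrizer `b_μ` then acts by zero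
(two positions of one column carry the same letter; the tree's `weylModule_eq_bot_of_card_lt`).
Blockwise, for IK's `{μ¹} ⊗ ⋯ ⊗ {μ^d} = c_{μ•} · (k^N)^{⊗n}` (Ikenmeyer–Kandasamy 2020 §3) this
gives `c^λ_{μ¹…μ^d} = 0` as soon as one `μ^i` has more than `N` rows
(`IK2020.multiLRCoeff_eq_zero_of_lt_card_parts`), through the word model: the block-`i` column
antisymmetrizer kills every function of words (`asAlgebraHom_blockPermHom_colAntisymmetrizer_eq_zero`),
hence so does `c_{μ•}` (a product containing that factor), and `c^λ_{μ•}` is the rank of `c_{μ•}`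
on `HW_λ` (`IK2020.multiLRCoeff_eq_finrank_range`).

## References

* [FultonHarrisGTM129] W. Fulton, J. Harris, *Representation Theory*, GTM 129, Thm. 6.3 (1),
  §6.1 Lemma 6.22.
* [IkenmeyerKandasamy2019] C. Ikenmeyer, U. Kandasamy, arXiv:1911.03990, §3.
-/

noncomputable section

open scoped BigOperators

namespace Literature.Computability.AlgebraicComplexity

open _root_.Literature.NumberTheory.DiophantineGeometry

variable (k : Type*) [Field k] {N d : ℕ} {n : Fin d → ℕ}

/-- Where a block permutation sends a position: block `i` is permuted by `τ`, the other blocks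
are fixed. [folklore] -/
private theorem blockPermHom_apply_finSigmaFinEquiv (i : Fin d) (τ : Equiv.Perm (Fin (n i)))
    (j : Fin d) (q : Fin (n j)) :
    IK2020.blockPermHom n i τ (finSigmaFinEquiv ⟨j, q⟩) =
      finSigmaFinEquiv ⟨j, (Pi.mulSingle (M := fun j => Equiv.Perm (Fin (n j))) i τ j) q⟩ := by
  simp only [IK2020.blockPermHom, MonoidHom.coe_comp, Function.comp_apply, MonoidHom.mulSingle_apply,
    MulEquiv.coe_toMonoidHom, Equiv.permCongrHom_coe, Equiv.permCongr_apply,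
    Equiv.symm_apply_apply, Equiv.Perm.sigmaCongrRightHom_apply]
  rfl

/-- A word with equal letters at two positions of block `i` is fixed by the block transposition of
those positions. [folklore] -/
private theorem comp_blockPermHom_swap_eq (i : Fin d) {p p' : Fin (n i)} (w : Word N (∑ j, n j))
    (hw : w (finSigmaFinEquiv ⟨i, p⟩) = w (finSigmaFinEquiv ⟨i, p'⟩)) :
    w ∘ ⇑(IK2020.blockPermHom n i (Equiv.swap p p')) = w := by
  funext x
  obtain ⟨⟨j, q⟩, rfl⟩ := finSigmaFinEquiv.surjective x
  rw [Function.comp_apply, blockPermHom_apply_finSigmaFinEquiv]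
  by_cases hji : j = i
  · subst hji
    rw [Pi.mulSingle_eq_same]
    rcases eq_or_ne q p with rfl | hqp
    · rw [Equiv.swap_apply_left, ← hw]
    rcases eq_or_ne q p' with rfl | hqp'
    · rw [Equiv.swap_apply_right, hw]
    rw [Equiv.swap_apply_of_ne_of_ne hqp hqp']
  · rw [Pi.mulSingle_eq_of_ne hji, Equiv.Perm.one_apply]

/-- **The block-`i` column antisymmetrizer of a partition with more than `N` rows kills every
function of words over `N` letters** (Fulton–Harris Thm. 6.3 (1), blockwise: two positions of the
first column in block `i` carry the same letter, and the transposition of them lies in the column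
stabilizer, `asAlgebraHom_colAntisymmetrizer_comp`). [cite: FultonHarrisGTM129, Thm. 6.3 (1)] -/
theorem asAlgebraHom_blockPermHom_colAntisymmetrizer_eq_zero [CharZero k] (i : Fin d)
    (μ : Nat.Partition (n i)) (hμ : N < μ.parts.card) :
    Representation.asAlgebraHom
      ((wordPermRep k N (∑ j, n j)).comp (IK2020.blockPermHom n i) :
        Representation k (Equiv.Perm (Fin (n i))) (Word N (∑ j, n j) → k))
      (colAntisymmetrizer k μ) = 0 := by
  classical
  set ρ : Representation k (Equiv.Perm (Fin (n i))) (Word N (∑ j, n j) → k) :=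
    (wordPermRep k N (∑ j, n j)).comp (IK2020.blockPermHom n i) with hρ
  set B := ρ.asAlgebraHom (colAntisymmetrizer k μ) with hB
  refine (Pi.basisFun k (Word N (∑ j, n j))).ext fun w => ?_
  rw [Pi.basisFun_apply, LinearMap.zero_apply]
  -- two positions of one column of `μ` in block `i` with the same letter
  have hμ' : Fintype.card (Fin N) < μ.parts.card := by rwa [Fintype.card_fin]
  obtain ⟨p, p', hpp', hcol, hw⟩ :=
    exists_ne_colOf_eq_apply_eq μ hμ' (fun q => w (finSigmaFinEquiv ⟨i, q⟩))
  -- the block transposition fixes `e_w`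
  have hfix : ρ (Equiv.swap p p') (Pi.single w (1 : k)) = Pi.single w 1 := by
    rw [hρ, MonoidHom.comp_apply, wordPermRep_apply]
    funext x
    rw [wordPerm_apply]
    by_cases hx : x = w
    · subst hx
      rw [comp_blockPermHom_swap_eq i x hw]
    · have hx' : x ∘ ⇑(IK2020.blockPermHom n i (Equiv.swap p p')) ≠ w := by
        intro h
        apply hx
        have := congrArg (fun v : Word N (∑ j, n j) =>
          v ∘ ⇑(IK2020.blockPermHom n i (Equiv.swap p p'))) h
        simp only [Function.comp_assoc, ← Equiv.Perm.coe_mul, ← map_mul, Equiv.swap_mul_self,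
          map_one, Equiv.Perm.coe_one, Function.comp_id] at this
        rw [this, comp_blockPermHom_swap_eq i w hw]
      rw [Pi.single_eq_of_ne hx', Pi.single_eq_of_ne hx]
  -- `B e_w = B (swap · e_w) = -B e_w`
  have key : B (Pi.single w 1) = -B (Pi.single w 1) := by
    conv_lhs => rw [← hfix]
    change (B ∘ₗ ρ (Equiv.swap p p')) _ = _
    rw [hB, asAlgebraHom_colAntisymmetrizer_comp ρ (swap_mem_colStabilizer μ hcol),
      Equiv.Perm.sign_swap hpp', LinearMap.smul_apply, Units.val_neg, Units.val_one,
      Int.cast_neg, Int.cast_one, neg_smul, one_smul]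
  have h2 : (2 : k) • B (Pi.single w 1) = 0 := by
    rw [two_smul]
    nth_rewrite 2 [key]
    exact add_neg_cancel _
  exact (smul_eq_zero.mp h2).resolve_left two_ne_zero

/-- Pushing forward along a homomorphism and then acting is acting through the composite
representation. [folklore] -/
private theorem asAlgebraHom_mapDomainAlgHom {G H V : Type*} [Group G] [Group H] [AddCommGroup V]
    [Module k V] (ρ : Representation k G V) (f : H →* G) (a : MonoidAlgebra k H) :
    ρ.asAlgebraHom (MonoidAlgebra.mapDomainAlgHom k k f a) =
      Representation.asAlgebraHom (ρ.comp f : Representation k H V) a := by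
  induction a using MonoidAlgebra.induction_on with
  | hM h =>
    rw [MonoidAlgebra.mapDomainAlgHom_apply, MonoidAlgebra.of_apply, MonoidAlgebra.mapDomain_single,
      ← MonoidAlgebra.of_apply, ← MonoidAlgebra.of_apply, Representation.asAlgebraHom_of,
      Representation.asAlgebraHom_of, MonoidHom.comp_apply]
  | hadd a b ha hb => rw [map_add, map_add, map_add, ha, hb]
  | hsmul r a ha => rw [map_smul, map_smul, map_smul, ha]

/-- **`c_{μ•}` acts by zero on the functions of words over `N` letters when some `μ^i` has more
than `N` rows** (the block-`i` factor `c_{μ^i} = a_{μ^i} b_{μ^i}` does).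
[cite: FultonHarrisGTM129, Thm. 6.3 (1)] -/
theorem IK2020.asAlgebraHom_multiYoungSymmetrizer_eq_zero [CharZero k]
    (μ : (i : Fin d) → Nat.Partition (n i)) {i : Fin d} (hμ : N < (μ i).parts.card) :
    (wordPermRep k N (∑ j, n j)).asAlgebraHom (IK2020.multiYoungSymmetrizer k μ) = 0 := by
  unfold IK2020.multiYoungSymmetrizer
  rw [map_list_prod, List.map_ofFn]
  apply List.prod_eq_zero
  rw [List.mem_ofFn]
  refine ⟨i, ?_⟩
  simp only [Function.comp_apply]
  rw [asAlgebraHom_mapDomainAlgHom,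
    show youngSymmetrizer k (μ i) = rowSymmetrizer k (μ i) * colAntisymmetrizer k (μ i) from rfl,
    map_mul, asAlgebraHom_blockPermHom_colAntisymmetrizer_eq_zero k i (μ i) hμ, mul_zero]

/-- **`c^λ_{μ¹…μ^d} = 0` if some `μ^i` has more than `N` rows** (`{μ^i} = S_{μ^i}(k^N) = 0`,
Fulton–Harris Thm. 6.3 (1); IK §3: the multi-Littlewood–Richardson coefficient of
`{μ¹} ⊗ ⋯ ⊗ {μ^d}`). Via the word model: `c^λ_{μ•}` is the rank of `c_{μ•}` on `HW_λ`
(`IK2020.multiLRCoeff_eq_finrank_range`) and `c_{μ•}` is zero on all functions of words.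
[cite: FultonHarrisGTM129, Thm. 6.3 (1)] [cite: IkenmeyerKandasamy2019, §3] -/
theorem IK2020.multiLRCoeff_eq_zero_of_lt_card_parts [CharZero k]
    (μ : (i : Fin d) → Nat.Partition (n i)) {i : Fin d} (hμ : N < (μ i).parts.card) {s : ℕ}
    (lam : Nat.Partition s) : IK2020.multiLRCoeff k N μ lam = 0 := by
  rw [IK2020.multiLRCoeff_eq_finrank_range, hwPermRep,
    finrank_range_asAlgebraHom_subrepresentation_of_mul_self _ _ _ _
      (IK2020.prod_coeff_sq_youngSymmetrizer_ne_zero k μ) (IK2020.multiYoungSymmetrizer_mul_self k μ),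
    IK2020.asAlgebraHom_multiYoungSymmetrizer_eq_zero k μ hμ, LinearMap.range_zero, bot_inf_eq,
    finrank_bot]

end Literature.Computability.AlgebraicComplexity

end
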